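import Summits.BirchSwinnertonDyer.BirchSwinnertonDyer.Theorems.BiquadraticEisensteinDescentHeegnerTwistCouplingInSupplyCornersEpFourFacts
import Literature.NumberTheory.EllipticCurves.BSDAnalyticRankTunnellCMProofs
import Literature.NumberTheory.EllipticCurves.NonEisensteinPrimeOfSurjective
import HarnessLib

set_option linter.dupNamespace false -- `Summit.BirchSwinnertonDyer.BirchSwinnertonDyer.Theorems.…` (summit = sub)
set_option autoImplicit false

/-!
# Crux `HeegnerTwistCouplingInSupply` (stmt-BirchSwinnertonDyer-21381) — the corners `W = E_{2p}` (every prime `p ≡ 3 (mod 4)`)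
# and `W = E_p` (`63/64` of the primes `p ≡ 7 (mod 8)`) modulo the THREE descent facts only: Modularity is discharged too

Route `BiquadraticEisensteinDescent` (cell `pub/bsd-wall`, width seat `bsd-wall-cm-bed-w4` g12; `--supports` 21381, helper). The corner
theorems of this layer (g10/g11 and this seat's `…CornersE2pFourFacts` / `…CornersEpFourFacts`) used Modularity `exists_isNewformOf`
for ONE purpose: the exact conductor `N(E_{2p}) = 64p²`, `N(E_p) = 32p²` (read off the CM functional equation by the level lemma), so
as to check the Heegner hypothesis at the primes of `N(W)`. But the Heegner hypothesis only needs the SUPPORT of the conductor, and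
that is modularity-free in the tree: `E_n` has good reduction at every prime `r ∤ 2n` (`hasGoodReductionAtPrime_congruentNumberCurve`,
Tate/Silverman VII.5.1) and a prime of good reduction does not divide `N(W)` (`not_dvd_conductorNorm_of_hasGoodReductionAtPrime`,
Silverman ATAEC IV.10.2(a), proved). Hence:

* §1 `dvd_two_mul_of_prime_dvd_conductorNorm` — every prime divisor of `N(E_n)` divides `2n` (no modularity);
* §2 `exists_cellData_two_p` — for every prime `p ≡ 3 (mod 4)`, `p ≥ 7`: an auxiliary prime `q ≡ 3 (mod 8)`, `q ≠ p`, with Monsky's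
  EVEN determinant `det M(p, q, 5) = 1`, `(−5q/p) = +1` and `h(K) < p` for every imaginary quadratic `K` of discriminant `−5q` —
  UNCONDITIONAL arithmetic (pins, kernel tables, class number formula bound); ★ `cruxOnE2pCorner_of_three_facts`;
* §3 `exists_cellData_p` — for every prime `p ≡ 7 (mod 8)` in the ladder's classes: primes `q ≡ 3`, `ℓ ≡ 5 (mod 8)` with `(q/p) = +1`,
  `(ℓ/p) = −1` and `h(K) < p` for every imaginary quadratic `K` of discriminant `−qℓ` — UNCONDITIONAL; ★ `cruxOnEpCorner_of_three_facts`.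

So the CONCLUSION of crux 21381 (a Heegner field `K′` of `N(W)` with `4 < |d_{K′}|`, `L(W^{(d_{K′})}, 1) ≠ 0`, `p ∤ h(K′)`) holds on these
families modulo exactly: Monsky's `2`-descent matrix theorem (Heath-Brown 1994, appendix), Burungale–Tian's rank-zero `2`-converse for CM
curves, and Burungale–Flach's BSD formula for CM curves of analytic rank `0` — the three DESCENT facts; continuation (Deuring–Hecke) and
conductor (Modularity) are tree theorems for `E_n`. HONEST FRAMING: typed sub-corner rungs on one CM family each; the crux (all CM `W`
of analytic rank one; residual C⁺) is untouched; BSD is not proved by any of this. THEOREMS ONLY. Supports stmt-BirchSwinnertonDyer-21381.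
-/

namespace Summit.BirchSwinnertonDyer.BirchSwinnertonDyer.Theorems.BiquadraticEisensteinDescentHeegnerTwistCouplingInSupplyCornersThreeFacts

open Literature.NumberTheory.EllipticCurves Literature.NumberTheory.EllipticCurves.HeathBrown1994
  Literature.NumberTheory.EllipticCurves.HeathBrown1994.Families
  Literature.NumberTheory.QuadraticFields Literature.NumberTheory.QuadraticFields.Quadratic
  Summit.BirchSwinnertonDyer.BirchSwinnertonDyer.Theorems.BiquadraticEisensteinDescentHeegnerTwistCouplingInSupplyThreeSquaresPin
  Summit.BirchSwinnertonDyer.BirchSwinnertonDyer.Theorems.BiquadraticEisensteinDescentHeegnerTwistCouplingInSupplyThreeSquaresPinDual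
  Summit.BirchSwinnertonDyer.BirchSwinnertonDyer.Theorems.BiquadraticEisensteinDescentHeegnerTwistCouplingInSupplyMonskyCells
  Summit.BirchSwinnertonDyer.BirchSwinnertonDyer.Theorems.BiquadraticEisensteinDescentHeegnerTwistCouplingInSupplyThreeSquaresPinRankZero
  Summit.BirchSwinnertonDyer.BirchSwinnertonDyer.Theorems.BiquadraticEisensteinDescentHeegnerTwistCouplingInSupplySizeIndivisibleSharp
  Summit.BirchSwinnertonDyer.BirchSwinnertonDyer.Theorems.BiquadraticEisensteinDescentHeegnerTwistCouplingInSupplyThreeSquaresPinCorner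
  Summit.BirchSwinnertonDyer.BirchSwinnertonDyer.Theorems.BiquadraticEisensteinDescentHeegnerTwistCouplingInSupplyIndefinitePin
  Summit.BirchSwinnertonDyer.BirchSwinnertonDyer.Theorems.BiquadraticEisensteinDescentHeegnerTwistCouplingInSupplyPartnerTables
  Summit.BirchSwinnertonDyer.BirchSwinnertonDyer.Theorems.BiquadraticEisensteinDescentHeegnerTwistCouplingInSupplyIndefinitePinWitness
  Summit.BirchSwinnertonDyer.BirchSwinnertonDyer.Theorems.BiquadraticEisensteinDescentHeegnerTwistCouplingInSupplyPartnerLadder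
  Summit.BirchSwinnertonDyer.BirchSwinnertonDyer.Theorems.BiquadraticEisensteinDescentHeegnerTwistCouplingInSupplyPartnerLadderRungs
  Summit.BirchSwinnertonDyer.BirchSwinnertonDyer.Theorems.BiquadraticEisensteinDescentHeegnerTwistCouplingInSupplyCornersE2pFourFacts

/-! ## §1 The support of `N(E_n)` without modularity -/

/-- **Every prime divisor of `N(E_n)` divides `2n`** (no modularity): a prime `r ∤ 2n` is a prime of good reduction of `E_n`
(`hasGoodReductionAtPrime_congruentNumberCurve`), hence does not divide the conductor (`not_dvd_conductorNorm_of_hasGoodReductionAtPrime`).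
[cite: SilvermanAEC2009, VII.5 Prop. 5.1(a)] [cite: SilvermanATAEC1994, Thm. IV.10.2(a)] -/
theorem dvd_two_mul_of_prime_dvd_conductorNorm {n r : ℕ} [(congruentNumberCurve n).IsElliptic] (hr : r.Prime)
    (h : r ∣ (congruentNumberCurve n).conductorNorm ℤ) : r ∣ 2 * n := by
  by_contra hnd
  haveI : Fact r.Prime := ⟨hr⟩
  exact not_dvd_conductorNorm_of_hasGoodReductionAtPrime (congruentNumberCurve n)
    (hasGoodReductionAtPrime_congruentNumberCurve hnd) h

/-- Prime divisors of `N(E_p)`, `p` an odd prime, are `2` or `p`. [cite: SilvermanATAEC1994, Thm. IV.10.2(a)] -/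
theorem eq_two_or_eq_of_prime_dvd_conductorNorm_p {p r : ℕ} [(congruentNumberCurve p).IsElliptic] (hp : p.Prime)
    (hr : r.Prime) (h : r ∣ (congruentNumberCurve p).conductorNorm ℤ) : r = 2 ∨ r = p := by
  rcases (Nat.Prime.dvd_mul hr).mp (dvd_two_mul_of_prime_dvd_conductorNorm hr h) with h2 | hp'
  · exact Or.inl ((Nat.prime_dvd_prime_iff_eq hr Nat.prime_two).mp h2)
  · exact Or.inr ((Nat.prime_dvd_prime_iff_eq hr hp).mp hp')

/-- Prime divisors of `N(E_{2p})`, `p` an odd prime, are `2` or `p`. [cite: SilvermanATAEC1994, Thm. IV.10.2(a)] -/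
theorem eq_two_or_eq_of_prime_dvd_conductorNorm_two_p {p r : ℕ} [(congruentNumberCurve (2 * p)).IsElliptic] (hp : p.Prime)
    (hr : r.Prime) (h : r ∣ (congruentNumberCurve (2 * p)).conductorNorm ℤ) : r = 2 ∨ r = p := by
  have h4 : r ∣ 2 * (2 * p) := dvd_two_mul_of_prime_dvd_conductorNorm hr h
  rcases (Nat.Prime.dvd_mul hr).mp h4 with h2 | h2p
  · exact Or.inl ((Nat.prime_dvd_prime_iff_eq hr Nat.prime_two).mp h2)
  · rcases (Nat.Prime.dvd_mul hr).mp h2p with h2 | hp'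
    · exact Or.inl ((Nat.prime_dvd_prime_iff_eq hr Nat.prime_two).mp h2)
    · exact Or.inr ((Nat.prime_dvd_prime_iff_eq hr hp).mp hp')

/-! ## §2 The corner `W = E_{2p}`: unconditional cell data, then three facts -/

/-- **Unconditional cell data for `E_{2p}`**: for every prime `p ≡ 3 (mod 4)`, `p ≥ 7` there is a prime `q ≡ 3 (mod 8)`, `q ≠ p`, with
Monsky's even determinant `det M(p, q, 5) = 1`, `(−5q/p) = +1`, and `h(K) < p` for every imaginary quadratic `K` of discriminant `−5q`
(cell A: `(3,+)` pin or table, `(5/p) = −1`; cell B on `p ≡ 3 (mod 8)`: `(3,−)` pin or table; dual pin on `p ≡ 7 (mod 8)`: `q < p`).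
No named fact. [cite: HeathBrown1994SelmerCongruentII, Appendix (Monsky), typescript p. 41 L20–L36] [cite: Oesterle1988Gauss, II §3 Proposition p. 57 (27)] -/
theorem exists_cellData_two_p {p : ℕ} (hp : p.Prime) (hp4 : p % 4 = 3) (h7 : 7 ≤ p) :
    ∃ q : ℕ, q.Prime ∧ q % 8 = 3 ∧ q ≠ p ∧ (monskyMatrixEven ![p, q, 5]).det = 1 ∧ jacobiSym (-(5 * (q : ℤ))) p = 1 ∧
      ∀ (K : Type) [Field K] [NumberField K], IsImaginaryQuadratic K →
        NumberField.discr K = -((5 * q : ℕ) : ℤ) → NumberField.classNumber K < p := by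
  have hp5 : (p % 5 = 2 ∨ p % 5 = 3) ∨ (p % 5 = 1 ∨ p % 5 = 4) := by
    have : p % 5 ≠ 0 := fun h0 => by
      have : 5 ∣ p := Nat.dvd_of_mod_eq_zero h0
      rcases (Nat.prime_dvd_prime_iff_eq Nat.prime_five hp).mp this with h
      omega
    omega
  rcases hp5 with hA | hB
  · obtain ⟨q, hq, hq8, hJ, hh⟩ := exists_threePlus_classNumber_lt hp hp4 hA h7
    have h5p : jacobiSym ((5 : ℕ) : ℤ) p = -1 := by exact_mod_cast jacobiSym_five_eq_neg_one (p := p) (by omega) hA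
    exact ⟨q, hq, hq8, ne_of_jacobiSym_ne_zero hp (by rw [hJ]; norm_num),
      det_monskyMatrixEven_cellA (p := p) hq Nat.prime_five hp4 hq8 (by norm_num) hJ h5p, jacobiSym_neg_five_mul_cellA hp4 hA hJ, hh⟩
  · rcases (show p % 8 = 3 ∨ p % 8 = 7 by omega) with h3 | h7'
    · obtain ⟨q, hq, hq8, hJ, hh⟩ := exists_threeMinus_classNumber_lt hp h3 hB
      exact ⟨q, hq, hq8, ne_of_jacobiSym_ne_zero hp (by rw [hJ]; norm_num), det_monskyMatrixEven_dualPin_five hp4 hB hq hq8 hJ,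
        jacobiSym_neg_five_mul_cellB hp4 hB hJ, hh⟩
    · obtain ⟨q, hq, hlt, hq8, hJ, -, hJ5, -⟩ := exists_dualPin_heegnerData hp h7' hB
      refine ⟨q, hq, hq8, by omega, det_monskyMatrixEven_dualPin_five hp4 hB hq hq8 hJ, hJ5, fun K _ _ hK hdK => ?_⟩
      refine classNumber_lt_of_natAbs_discr_lt_six_mul hK ?_ (by omega) ?_
      · rw [hdK, Int.natAbs_neg, Int.natAbs_natCast]
        have := hq.two_le
        omega
      · rw [hdK, Int.natAbs_neg, Int.natAbs_natCast]
        omega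

/-- ★ **THE CONGRUENT CORNER `W = E_{2p}`, THREE NAMED FACTS: every prime `p ≡ 3 (mod 4)`, `p ≥ 7`** — modulo Monsky (even) +
Burungale–Tian + Burungale–Flach ONLY there is a Heegner field `K′` of `N(E_{2p})` with `4 < |d_{K′}|`, `L(E_{2p}^{(d_{K′})}, 1) ≠ 0`,
`h(K′) < p` and `p ∤ h(K′)`. [cite: HeathBrown1994SelmerCongruentII, Appendix (Monsky), typescript p. 41 L20–L36]
[cite: BurungaleTian2026, Thm. 1.1] [cite: BurungaleFlach2024, Thm. 1.1 and Cor. 2] [cite: KoblitzECMF1993, Ch. II §5, Theorem (p. 84)] -/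
theorem cruxOnE2pCorner_of_three_facts (hM : monsky_card_selmerGroup_two_even)
    (hBT : burungaleTian_analyticRank_eq_zero_of_selmerCorank_eq_zero_of_hasCM) (hBF : bsdTriple_of_hasCM_of_L_one_ne_zero) :
    ∀ (p : ℕ) [Fact p.Prime] [(congruentNumberCurve (2 * p)).IsElliptic]
      [(congruentNumberCurve (2 * p)).IsGloballyMinimal]
      [NeZero ((congruentNumberCurve (2 * p)).conductorNorm ℤ)],
      p % 4 = 3 → 7 ≤ p →
      ∃ (K : Type) (_ : Field K) (_ : NumberField K),
        IsImaginaryQuadratic K ∧ 4 < (NumberField.discr K).natAbs ∧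
        SatisfiesHeegnerHypothesis ((congruentNumberCurve (2 * p)).conductorNorm ℤ) K ∧
        ((congruentNumberCurve (2 * p)).quadraticTwist (NumberField.discr K : ℚ)).entireLFunction 1 ≠ 0 ∧
        NumberField.classNumber K < p ∧ ¬ p ∣ NumberField.classNumber K := by
  intro p hpF _ _ _ hp4 h7
  have hp : p.Prime := hpF.out
  obtain ⟨q, hq, hq8, hqp, hdet, hJ5, hh⟩ := exists_cellData_two_p hp hp4 h7
  obtain ⟨-, -, -, hL⟩ := analyticRank_eq_zero_of_det_even_fourFacts hM hBT hBF hp hq Nat.prime_five (by omega) (by omega)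
    (by norm_num) (Ne.symm hqp) (by rintro rfl; omega) (by rintro rfl; omega) hdet
  obtain ⟨K, iF, iN, hK, hdK, hH', hcl⟩ := exists_witnessField_five_of (N := (congruentNumberCurve (2 * p)).conductorNorm ℤ)
    hq hq8 hJ5 hh (fun r hr hrN => eq_two_or_eq_of_prime_dvd_conductorNorm_two_p hp hr hrN)
  refine ⟨K, iF, iN, hK, ?_, hH', ?_, hcl, fun hdvd =>
    absurd (Nat.le_of_dvd (NumberField.classNumber_pos K) hdvd) (not_le.mpr hcl)⟩
  · rw [hdK, Int.natAbs_neg, Int.natAbs_natCast]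
    have := hq.two_le
    omega
  · rw [hdK, quadraticTwist_congruentNumberCurve, Int.natAbs_neg, Int.natAbs_natCast]
    have h55 : 2 * p * (5 * q) = 2 * p * (q * 5) := by ring
    rw [h55]
    exact hL

/-! ## §3 The corner `W = E_p`: unconditional cell data, then three facts -/

/-- Cell data from a fixed partner `q₀ ≡ 3 (mod 8)` above its threshold (three-squares pin, class number formula bound). No named fact.
[cite: Oesterle1988Gauss, II §3 Proposition p. 57 (27)] -/
theorem cellData_partnerQ {p q₀ : ℕ} (hp : p.Prime) (hp8 : p % 8 = 7) (hq₀ : q₀.Prime) (hq₀8 : q₀ % 8 = 3) {P : ℕ}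
    (hkey : (8 : ℝ) ^ 8 * ((2 * q₀ : ℕ) : ℝ) ^ 5 ≤ (2.718 * 3.1415) ^ 8 * (P : ℝ) ^ 3)
    (hJq : jacobiSym (p : ℤ) q₀ = -1) (hPp : P ≤ p) :
    ∃ q l : ℕ, q.Prime ∧ q % 8 = 3 ∧ l.Prime ∧ l % 8 = 5 ∧ jacobiSym (q : ℤ) p = 1 ∧ jacobiSym (l : ℤ) p = -1 ∧
      ∀ (K : Type) [Field K] [NumberField K], IsImaginaryQuadratic K →
        NumberField.discr K = -((q * l : ℕ) : ℤ) → NumberField.classNumber K < p := by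
  obtain ⟨ℓ, hℓ, hℓlt, hℓ8, hJℓ⟩ := threeSquaresPin p hp (by omega)
  have hxc : ((q₀ * ℓ : ℕ) : ℝ) < ((2 * q₀ : ℕ) : ℝ) * p := by
    have h1 : q₀ * ℓ < 2 * q₀ * p := by
      have := hq₀.pos
      nlinarith
    exact_mod_cast h1
  exact ⟨q₀, ℓ, hq₀, hq₀8, hℓ, hℓ8, jacobiSym_eq_one_of_jacobiSym_eq_neg_one (by omega) (by omega) hJq, hJℓ,
    classNumber_lt_of_lever hq₀ hℓ hℓ8 hxc hkey hPp⟩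

/-- Cell data from a fixed partner `ℓ₀ ≡ 5 (mod 8)` above its threshold (indefinite `(3,+)` pin, class number formula bound). No named fact.
[cite: Oesterle1988Gauss, II §3 Proposition p. 57 (27)] -/
theorem cellData_partnerL {p ℓ₀ : ℕ} (hp : p.Prime) (hp8 : p % 8 = 7) (hℓ₀ : ℓ₀.Prime) (hℓ₀8 : ℓ₀ % 8 = 5) {P : ℕ}
    (hP800 : 800 ≤ P) (hkey : (8 : ℝ) ^ 8 * ((10 * ℓ₀ : ℕ) : ℝ) ^ 5 ≤ (2.718 * 3.1415) ^ 8 * (P : ℝ) ^ 3)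
    (hJℓ : jacobiSym (ℓ₀ : ℤ) p = -1) (hPp : P ≤ p) :
    ∃ q l : ℕ, q.Prime ∧ q % 8 = 3 ∧ l.Prime ∧ l % 8 = 5 ∧ jacobiSym (q : ℤ) p = 1 ∧ jacobiSym (l : ℤ) p = -1 ∧
      ∀ (K : Type) [Field K] [NumberField K], IsImaginaryQuadratic K →
        NumberField.discr K = -((q * l : ℕ) : ℤ) → NumberField.classNumber K < p := by
  obtain ⟨q, hq, hq8, hJq, hqle⟩ := indefinitePinThreePlus hp (by omega) (hP800.trans hPp)
  have hxc : ((q * ℓ₀ : ℕ) : ℝ) < ((10 * ℓ₀ : ℕ) : ℝ) * p := by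
    have hqlt : q < 10 * p := by
      rcases hqle.lt_or_eq with h | h
      · exact h
      · exfalso; omega
    have h1 : q * ℓ₀ < 10 * ℓ₀ * p := by
      have := hℓ₀.pos
      nlinarith
    exact_mod_cast h1
  exact ⟨q, ℓ₀, hq, hq8, hℓ₀, hℓ₀8, hJq, hJℓ, classNumber_lt_of_lever hq hℓ₀ hℓ₀8 hxc hkey hPp⟩

/-- **Unconditional cell data for `E_p` on the ladder's classes**: for every prime `p ≡ 7 (mod 8)` with `p ≡ 2 (3)` or `p ≡ ±2 (5)` or
`(p/11) = −1` or `(p/19) = −1` or `(p/43) = −1` or `(13/p) = −1`: primes `q ≡ 3 (mod 8)`, `ℓ ≡ 5 (mod 8)` with `(q/p) = +1`, `(ℓ/p) = −1`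
and `h(K) < p` for every imaginary quadratic `K` of discriminant `−qℓ` (partners `3, 5, 11, 19, 43, 13`: pins, kernel tables, class
number formula bound). No named fact. [cite: Oesterle1988Gauss, II §3 Proposition p. 57 (27)] [cite: Cohen1993, §5.3.1 Algorithm 5.3.5] -/
theorem exists_cellData_p {p : ℕ} (hp : p.Prime) (hp8 : p % 8 = 7)
    (hcase : p % 3 = 2 ∨ p % 5 = 2 ∨ p % 5 = 3 ∨ jacobiSym (p : ℤ) 11 = -1 ∨ jacobiSym (p : ℤ) 19 = -1 ∨
      jacobiSym (p : ℤ) 43 = -1 ∨ jacobiSym (13 : ℤ) p = -1) :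
    ∃ q l : ℕ, q.Prime ∧ q % 8 = 3 ∧ l.Prime ∧ l % 8 = 5 ∧ jacobiSym (q : ℤ) p = 1 ∧ jacobiSym (l : ℤ) p = -1 ∧
      ∀ (K : Type) [Field K] [NumberField K], IsImaginaryQuadratic K →
        NumberField.discr K = -((q * l : ℕ) : ℤ) → NumberField.classNumber K < p := by
  have hp4 : p % 4 = 3 := by omega
  -- partner `5` (cell A): also serves `p = 7`
  by_cases h5 : p % 5 = 2 ∨ p % 5 = 3
  · obtain ⟨q, hq, hq8, hJ, hh⟩ := exists_threePlus_classNumber_lt hp hp4 h5 (by omega)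
    refine ⟨q, 5, hq, hq8, Nat.prime_five, by norm_num, hJ,
      by exact_mod_cast jacobiSym_five_eq_neg_one (p := p) (by omega) h5, fun K _ _ hK hdK => hh K hK ?_⟩
    rw [hdK, Nat.mul_comm]
  -- partner `3` (three-squares pin), `p ≡ 23 (mod 24)`
  by_cases h3 : p % 3 = 2
  · obtain ⟨ℓ, hℓ, hlt, hℓ8, hJ⟩ := threeSquaresPin p hp hp4
    refine ⟨3, ℓ, Nat.prime_three, by norm_num, hℓ, hℓ8, by exact_mod_cast jacobiSym_three_eq_one (p := p) (by omega), hJ,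
      fun K _ _ hK hdK => ?_⟩
    refine classNumber_lt_of_natAbs_discr_lt_six_mul hK ?_ (by omega) ?_
    · rw [hdK, Int.natAbs_neg, Int.natAbs_natCast]
      have := hℓ.two_le
      omega
    · rw [hdK, Int.natAbs_neg, Int.natAbs_natCast]
      omega
  have h8 : 8 ≤ p := by
    by_contra h
    have : p = 7 := by have := hp.two_le; omega
    exact h5 (Or.inl (by omega))
  have hrest : jacobiSym (p : ℤ) 11 = -1 ∨ jacobiSym (p : ℤ) 19 = -1 ∨ jacobiSym (p : ℤ) 43 = -1 ∨
      jacobiSym (13 : ℤ) p = -1 := by tauto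
  rcases hrest with h11 | h19 | h43 | h13
  · -- partner `11`
    rcases Nat.lt_or_ge p 146 with hlt | hge
    · obtain ⟨l, hlmem, -, hres, hh⟩ := tableQ11 p (Finset.mem_range.mpr hlt) hp8 (forall_sq_ne_of_jacobiSym_eq_neg_one h11)
      obtain ⟨hl, hl8⟩ := partnersL_spec l hlmem
      exact ⟨11, l, by norm_num, by norm_num, hl, hl8, jacobiSym_eq_one_of_jacobiSym_eq_neg_one hp4 (by norm_num) h11,
        jacobiSym_eq_neg_one_of_table_one_mod_four hl (by omega) (by omega) hres, classNumber_lt_of_count (by norm_num) hl hh⟩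
    · exact cellData_partnerQ hp hp8 (by norm_num) (by norm_num) (q₀ := 11) (P := 146) (by norm_num) h11 hge
  · -- partner `19`
    rcases Nat.lt_or_ge p 362 with hlt | hge
    · obtain ⟨l, hlmem, -, hres, hh⟩ := tableQ19 p (Finset.mem_range.mpr hlt) hp8 (forall_sq_ne_of_jacobiSym_eq_neg_one h19)
      obtain ⟨hl, hl8⟩ := partnersL_spec l hlmem
      exact ⟨19, l, by norm_num, by norm_num, hl, hl8, jacobiSym_eq_one_of_jacobiSym_eq_neg_one hp4 (by norm_num) h19,
        jacobiSym_eq_neg_one_of_table_one_mod_four hl (by omega) (by omega) hres, classNumber_lt_of_count (by norm_num) hl hh⟩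
    · exact cellData_partnerQ hp hp8 (by norm_num) (by norm_num) (q₀ := 19) (P := 362) (by norm_num) h19 hge
  · -- partner `43`
    rcases Nat.lt_or_ge p 1409 with hlt | hge
    · obtain ⟨l, hlmem, -, hres, hh⟩ :=
        tableQ43 p (Finset.mem_range.mpr hlt) hp8 (forall_sq_ne_of_jacobiSym_eq_neg_one h43) h8
      obtain ⟨hl, hl8⟩ := partnersL_spec l hlmem
      exact ⟨43, l, by norm_num, by norm_num, hl, hl8, jacobiSym_eq_one_of_jacobiSym_eq_neg_one hp4 (by norm_num) h43,
        jacobiSym_eq_neg_one_of_table_one_mod_four hl (by omega) (by omega) hres, classNumber_lt_of_count (by norm_num) hl hh⟩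
    · exact cellData_partnerQ hp hp8 (by norm_num) (by norm_num) (q₀ := 43) (P := 1409) (by norm_num) h43 hge
  · -- partner `13`
    have h13' : jacobiSym ((13 : ℕ) : ℤ) p = -1 := by exact_mod_cast h13
    have hres13 := forall_sq_ne_thirteen (by omega) h13
    rcases Nat.lt_or_ge p 2805 with hlt | hge
    · obtain ⟨q, hqmem, -, hres, hh⟩ :
          ∃ q ∈ [3, 19, 11, 43, 59, 83, 107], q ≤ 10 * p ∧ (∀ x < q, x * x % q ≠ p % q) ∧
            BinQF.classNumberCount (q * 13) < p := by
        rcases Nat.lt_or_ge p 1400 with h1400 | h1400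
        · exact tableL13a p (Finset.mem_range.mpr h1400) hp8 hres13 h8
        · exact tableL13b p (Finset.mem_range.mpr hlt) h1400 hp8 hres13
      obtain ⟨hq, hq8⟩ := partnersQ_spec q hqmem
      exact ⟨q, 13, hq, hq8, by norm_num, by norm_num, jacobiSym_eq_one_of_table hq hp4 hq8 hres, h13',
        classNumber_lt_of_count hq (by norm_num) hh⟩
    · exact cellData_partnerL hp hp8 (by norm_num) (by norm_num) (ℓ₀ := 13) (P := 2805) (by norm_num) (by norm_num) h13' hge

/-- ★ **THE CORNER `W = E_p`, partners `{3, 5, 11, 13, 19, 43}`, THREE NAMED FACTS**: for every prime `p ≡ 7 (mod 8)` with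
`p ≡ 2 (mod 3)` or `p ≡ ±2 (mod 5)` or `(p/11) = −1` or `(p/19) = −1` or `(p/43) = −1` or `(13/p) = −1` — modulo Monsky (odd) +
Burungale–Tian + Burungale–Flach ONLY — a Heegner field `K′` of `N(E_p)` with `4 < |d_{K′}|`, `L(E_p^{(d_{K′})}, 1) ≠ 0`, `h(K′) < p`,
`p ∤ h(K′)`. [cite: HeathBrown1994SelmerCongruentII, Appendix (Monsky), typescript p. 39 L27–L33] [cite: BurungaleTian2026, Thm. 1.1]
[cite: BurungaleFlach2024, Thm. 1.1 and Cor. 2] [cite: KoblitzECMF1993, Ch. II §5, Theorem (p. 84)] -/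
theorem cruxOnEpCorner_of_three_facts (hM : monsky_card_selmerGroup_two_odd)
    (hBT : burungaleTian_analyticRank_eq_zero_of_selmerCorank_eq_zero_of_hasCM) (hBF : bsdTriple_of_hasCM_of_L_one_ne_zero) :
    ∀ (p : ℕ) [Fact p.Prime] [(congruentNumberCurve p).IsElliptic] [(congruentNumberCurve p).IsGloballyMinimal]
      [NeZero ((congruentNumberCurve p).conductorNorm ℤ)],
      p % 8 = 7 →
      (p % 3 = 2 ∨ p % 5 = 2 ∨ p % 5 = 3 ∨ jacobiSym (p : ℤ) 11 = -1 ∨ jacobiSym (p : ℤ) 19 = -1 ∨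
        jacobiSym (p : ℤ) 43 = -1 ∨ jacobiSym (13 : ℤ) p = -1) →
      ∃ (K : Type) (_ : Field K) (_ : NumberField K),
        IsImaginaryQuadratic K ∧ 4 < (NumberField.discr K).natAbs ∧
        SatisfiesHeegnerHypothesis ((congruentNumberCurve p).conductorNorm ℤ) K ∧
        ((congruentNumberCurve p).quadraticTwist (NumberField.discr K : ℚ)).entireLFunction 1 ≠ 0 ∧
        NumberField.classNumber K < p ∧ ¬ p ∣ NumberField.classNumber K := by
  intro p hpF _ _ _ hp8 hcase
  have hp : p.Prime := hpF.out
  have hp4 : p % 4 = 3 := by omega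
  obtain ⟨q, l, hq, hq8, hl, hl8, hJq, hJl, hh⟩ := exists_cellData_p hp hp8 hcase
  have hqp : q ≠ p := ne_of_jacobiSym_ne_zero hp (by rw [hJq]; norm_num)
  have hlp : l ≠ p := ne_of_jacobiSym_ne_zero hp (by rw [hJl]; norm_num)
  have hdet := det_monskyMatrixOdd_cell_seven_mod_eight (p := p) hp hq hl hp8 hq8 hl8 hJl
  obtain ⟨-, -, -, hL⟩ := analyticRank_eq_zero_of_det_odd_fourFacts hM hBT hBF hp hq hl (by omega) (by omega) (by omega)
    (Ne.symm hqp) (Ne.symm hlp) (by rintro rfl; omega) hdet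
  obtain ⟨K, iF, iN, hK, hdK, hH', hcl⟩ := exists_witnessField_of (N := (congruentNumberCurve p).conductorNorm ℤ)
    hq hq8 hl hl8 (jacobiSym_neg_mul_eq_one hp4 hJq hJl) hh
    (fun r hr hrN => eq_two_or_eq_of_prime_dvd_conductorNorm_p hp hr hrN)
  refine ⟨K, iF, iN, hK, ?_, hH', ?_, hcl, fun hdvd =>
    absurd (Nat.le_of_dvd (NumberField.classNumber_pos K) hdvd) (not_le.mpr hcl)⟩
  · rw [hdK, Int.natAbs_neg, Int.natAbs_natCast]
    have h2 : 2 ≤ q := hq.two_le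
    have h5' : 5 ≤ l := by have := hl.two_le; omega
    calc 4 < 2 * 5 := by norm_num
      _ ≤ q * l := Nat.mul_le_mul h2 h5'
  · rw [hdK, quadraticTwist_congruentNumberCurve, Int.natAbs_neg, Int.natAbs_natCast]
    exact hL

end Summit.BirchSwinnertonDyer.BirchSwinnertonDyer.Theorems.BiquadraticEisensteinDescentHeegnerTwistCouplingInSupplyCornersThreeFacts
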